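import Literature.Geometry.Symplectic.GromovR4RelEnd
import Literature.Geometry.Symplectic.AlmostComplexStructure
import Summits.SmoothPoincare4.SmoothPoincare4.Theses.SymplecticOrigami
import HarnessLib

/-!
# Crux `GromovRecognitionRelEnd` (stmt-SmoothPoincare4-11009) — ideator 2, round 1: first lemmas

Sketch file of the crux-ideate seat `planner-cruxidea-stmt-SmoothPoincare4-11009-2-0`.
Nothing here is a route item; the `def`s are the FIRST LEMMAS of the two idea cards
`ruled-cap-incidence-shear` and `line-germ-homogeneity`, stated over existing declarations so
that they elaborate, plus the (pure-logic, proved) composition showing how card 1 reaches the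
crux BY NAME.

* `TameChartRelEnd`  — card 1, transfer target C⁺ ("tame J-ruled chart, standard off a compact
  set"): under the crux's hypotheses there are an `sf`-tame almost complex structure `J`, a
  diffeomorphism `Φ : M ≃ₘ ℝ⁴` equal to `ψ` off a compact `K₁ ⊇ K`, such that `Φ^*ω₀` tames `J`.
  (Geometric heart: incidence chart of the two `J`-rulings of an `S² × S²`-cap, cut off along
  the decaying shear; Gromov 1985 2.4.A₁, Wendl 2018 Thm 6.8 / Thm 9.4 proof.)
* `TameMoserRelEnd`  — card 1, first lemma (soft finish): two symplectic forms `sf` and `Φ^*ω₀`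
  on `M` that agree off a compact set and tame a common `J` are related by a diffeomorphism that
  is `ψ` off a compact set (linear path is `J`-tame hence symplectic, `H²_c(ℝ⁴) = 0`,
  compactly supported Moser; Wendl 2018 proof of Thm 6.8, last paragraph, made relative).
* `GromovRecognitionRelEnd_of` — PROVED: `TameChartRelEnd → TameMoserRelEnd → crux`.
* `NoSymplecticSphereOfAspherical` — card 2, first lemma: in the crux's `M` (closed `sf`,
  `π₂ = 0`) there is no symplectically immersed 2-sphere (given as two `ℂ`-charts glued by
  `z ↦ z⁻¹`, as in `Literature.Geometry.Symplectic.jSphere_const_of_exact_tame`); this is the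
  minimality of the `ℂP²`-cap `X = M_{<R''} ∪ L∞` and of `X ∖ L∞` needed for Wendl Thm D(2).
* `tameSplit` — card 1, stub (S5), PROVED: the pointwise tame-split lemma on `ℝ⁴`.
* `CutAndExtend` — card 2, end glue: a symplectic open embedding of the sub-level
  `K ∪ {‖ψ‖ < R₃}` onto the ball `B(0, R₃)` that agrees with `ψ` on the shell `R₂ < ‖ψ‖ < R₃`
  extends by `ψ` to the `Φ` demanded by the crux.
-/

noncomputable section

open scoped Manifold ContDiff Topology
open TopologicalSpace Set Literature.Geometry.Kaehler Literature.Geometry.Symplectic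

namespace Summit.SmoothPoincare4.SmoothPoincare4.Cruxes.GromovRecognitionRelEnd.SketchIdeator2

/-- Local notation for the model space `ℝ⁴`. -/
local notation "E4" => EuclideanSpace ℝ (Fin 4)

/-- **Card 1, transfer target C⁺ — a tame `J`-ruled chart standard off a compact set.**
Same binders and hypotheses as the crux; conclusion: an almost complex structure `J` on `M`
tamed by `sf`, a diffeomorphism `Φ : M ≃ₘ ℝ⁴` with `Φ = ψ` off a compact `K₁ ⊇ K`, and
`ω₀(dΦ v, dΦ (J v)) > 0` for `v ≠ 0` (the pull-back `Φ^*ω₀` tames `J`). -/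
def TameChartRelEnd : Prop :=
  ∀ (M : Type) [TopologicalSpace M] [T2Space M] [SecondCountableTopology M]
    [ChartedSpace E4 M] [IsManifold (𝓡 4) ∞ M] [ConnectedSpace M]
    (sf : MForm (𝓡 4) M ℝ 2) (K : Set M) (R : ℝ) (ψ : M → E4) (χ : E4 → M),
    (∀ x : M, Subsingleton (π_ 2 M x)) →
    IsSmoothForm sf → IsClosedForm sf →
    (∀ x (v : TangentSpace (𝓡 4) x), v ≠ 0 → ∃ w, sf x ![v, w] ≠ 0) →
    (∀ R', R ≤ R' → IsCompact (K ∪ {x | ‖ψ x‖ ≤ R'})) →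
    ContMDiffOn (𝓡 4) 𝓘(ℝ, E4) ∞ ψ Kᶜ →
    ContMDiffOn 𝓘(ℝ, E4) (𝓡 4) ∞ χ (Metric.closedBall (0 : E4) R)ᶜ →
    Set.BijOn ψ Kᶜ (Metric.closedBall (0 : E4) R)ᶜ →
    (∀ x, x ∈ Kᶜ → χ (ψ x) = x) →
    (∀ x, x ∈ Kᶜ → ∀ v w, sf x ![v, w] =
      stdSymplecticForm (mfderiv (𝓡 4) 𝓘(ℝ, E4) ψ x v) (mfderiv (𝓡 4) 𝓘(ℝ, E4) ψ x w)) →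
    ∃ (J : AlmostComplexStructure (𝓡 4) ∞ M) (Φ : M ≃ₘ⟮𝓡 4, 𝓡 4⟯ E4) (K₁ : Set M),
      IsCompact K₁ ∧ K ⊆ K₁ ∧ J.IsTamedBy sf ∧ (∀ x, x ∉ K₁ → Φ x = ψ x) ∧
      ∀ x (v : TangentSpace (𝓡 4) x), v ≠ 0 →
        0 < stdSymplecticForm (mfderiv (𝓡 4) 𝓘(ℝ, E4) Φ x v)
              (mfderiv (𝓡 4) 𝓘(ℝ, E4) Φ x (J x v))

/-- **Card 1, first lemma — compactly supported tame Moser, relative to the end.**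
`sf` smooth closed, `Φ : M ≃ₘ ℝ⁴` a diffeomorphism equal to `ψ` off the compact `K`, `sf = ψ^*ω₀`
off `K`, and an almost complex structure `J` tamed both by `sf` and by `Φ^*ω₀`; then some
`Φ' : M ≃ₘ ℝ⁴` satisfies `sf = Φ'^*ω₀` everywhere and `Φ' = ψ` off a compact set.
(Proof plan: `ω_s = (1-s) sf + s Φ^*ω₀` tames `J` for all `s`, so is symplectic; `Φ^*ω₀ - sf`
is closed and supported in `K`; `H²_c(M) = H²_c(ℝ⁴) = 0` gives a compactly supported primitive;
the Moser vector field is compactly supported, its time-one map `ρ` fixes the end and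
`Φ' = Φ ∘ ρ`.) -/
def TameMoserRelEnd : Prop :=
  ∀ (M : Type) [TopologicalSpace M] [T2Space M] [SecondCountableTopology M]
    [ChartedSpace E4 M] [IsManifold (𝓡 4) ∞ M]
    (sf : MForm (𝓡 4) M ℝ 2) (J : AlmostComplexStructure (𝓡 4) ∞ M)
    (K : Set M) (ψ : M → E4) (Φ : M ≃ₘ⟮𝓡 4, 𝓡 4⟯ E4),
    IsSmoothForm sf → IsClosedForm sf → IsCompact K →
    (∀ x, x ∉ K → Φ x = ψ x) →
    (∀ x, x ∉ K → ∀ v w, sf x ![v, w] =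
      stdSymplecticForm (mfderiv (𝓡 4) 𝓘(ℝ, E4) ψ x v) (mfderiv (𝓡 4) 𝓘(ℝ, E4) ψ x w)) →
    J.IsTamedBy sf →
    (∀ x (v : TangentSpace (𝓡 4) x), v ≠ 0 →
      0 < stdSymplecticForm (mfderiv (𝓡 4) 𝓘(ℝ, E4) Φ x v)
            (mfderiv (𝓡 4) 𝓘(ℝ, E4) Φ x (J x v))) →
    ∃ Φ' : M ≃ₘ⟮𝓡 4, 𝓡 4⟯ E4,
      (∀ x v w, sf x ![v, w] =
        stdSymplecticForm (mfderiv (𝓡 4) 𝓘(ℝ, E4) Φ' x v) (mfderiv (𝓡 4) 𝓘(ℝ, E4) Φ' x w)) ∧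
      ∃ K' : Set M, IsCompact K' ∧ ∀ x, x ∉ K' → Φ' x = ψ x

/-- **Card 1 reaches the crux by name**: pure logic. -/
theorem GromovRecognitionRelEnd_of (hC : TameChartRelEnd) (hM : TameMoserRelEnd) :
    Summit.SmoothPoincare4.SmoothPoincare4.Theses.SymplecticOrigami.GromovRecognitionRelEnd := by
  intro M _ _ _ _ _ _ sf K R ψ χ hπ hsm hcl hnd hend hψ hχ hbij hinv hstd
  obtain ⟨J, Φ, K₁, hK₁, hKK₁, hJ, hΦψ, htame⟩ :=
    hC M sf K R ψ χ hπ hsm hcl hnd hend hψ hχ hbij hinv hstd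
  exact hM M sf J K₁ ψ Φ hsm hcl hK₁ hΦψ
    (fun x hx v w => hstd x (fun hxK => hx (hKK₁ hxK)) v w) hJ htame

/-- The same composition for the verbatim Literature named fact (the SymplecticCap copy of the
crux is this constant by `Iff.rfl`). -/
theorem gromov_recognitionR4_relEnd_of (hC : TameChartRelEnd) (hM : TameMoserRelEnd) :
    Literature.Geometry.Symplectic.gromov_recognitionR4_relEnd :=
  GromovRecognitionRelEnd_of hC hM

/-- **Card 2, first lemma — no symplectic sphere in an aspherical symplectic 4-manifold.**
For `sf` smooth and closed on `M` with `π₂(M, x) = 0` for all `x`, and `u, v : ℂ → M` smooth with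
`v z = u z⁻¹` for `z ≠ 0` (the two affine charts of a smooth map `ℂP¹ → M`), the pull-back `u^*sf`
cannot be a positive area form in both charts. (Proof plan: the glued sphere is null-homotopic,
so `∫ u^*sf = 0` by Stokes for the closed form `sf`, while positivity gives `∫ u^*sf > 0`.)
This is the minimality of the cap `X ⊃ L∞` and of `X ∖ L∞` (no exceptional sphere, indeed no
symplectic sphere at all, inside `M`) required by Wendl 2018 Thm D(2) / Thm F. -/
def NoSymplecticSphereOfAspherical : Prop :=
  ∀ (M : Type) [TopologicalSpace M] [T2Space M] [SecondCountableTopology M]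
    [ChartedSpace E4 M] [IsManifold (𝓡 4) ∞ M]
    (sf : MForm (𝓡 4) M ℝ 2) (u v : ℂ → M),
    (∀ x : M, Subsingleton (π_ 2 M x)) → IsSmoothForm sf → IsClosedForm sf →
    ContMDiff 𝓘(ℝ, ℂ) (𝓡 4) ∞ u → ContMDiff 𝓘(ℝ, ℂ) (𝓡 4) ∞ v →
    (∀ z : ℂ, z ≠ 0 → v z = u z⁻¹) →
    ¬ ((∀ (z ζ : ℂ), ζ ≠ 0 →
          0 < sf (u z) ![mfderiv 𝓘(ℝ, ℂ) (𝓡 4) u z ζ, mfderiv 𝓘(ℝ, ℂ) (𝓡 4) u z (Complex.I * ζ)]) ∧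
       (∀ (z ζ : ℂ), ζ ≠ 0 →
          0 < sf (v z) ![mfderiv 𝓘(ℝ, ℂ) (𝓡 4) v z ζ, mfderiv 𝓘(ℝ, ℂ) (𝓡 4) v z (Complex.I * ζ)]))

/-- **Card 2, end glue — cut at a round sphere in the standard region and extend by `ψ`.**
With the crux's end data (`K`, `R`, `ψ`, the ends clause, `sf = ψ^*ω₀` off `K`), radii
`R ≤ R₂ < R₃`, and a map `Φ₀` which is a symplectic open embedding of the sub-level
`U = K ∪ {‖ψ‖ < R₃}` onto the open ball `B(0, R₃)` agreeing with `ψ` on the shell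
`{x ∉ K | R₂ < ‖ψ x‖ < R₃}`, the crux's conclusion holds (`Φ = Φ₀` on `U`, `= ψ` beyond). -/
def CutAndExtend : Prop :=
  ∀ (M : Type) [TopologicalSpace M] [T2Space M] [SecondCountableTopology M]
    [ChartedSpace E4 M] [IsManifold (𝓡 4) ∞ M]
    (sf : MForm (𝓡 4) M ℝ 2) (K : Set M) (R R₂ R₃ : ℝ) (ψ : M → E4) (Φ₀ : M → E4),
    IsSmoothForm sf →
    (∀ R', R ≤ R' → IsCompact (K ∪ {x | ‖ψ x‖ ≤ R'})) →
    ContMDiffOn (𝓡 4) 𝓘(ℝ, E4) ∞ ψ Kᶜ →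
    Set.BijOn ψ Kᶜ (Metric.closedBall (0 : E4) R)ᶜ →
    (∀ x ∈ Kᶜ, Function.Bijective (mfderiv (𝓡 4) 𝓘(ℝ, E4) ψ x)) →
    (∀ x, x ∈ Kᶜ → ∀ v w, sf x ![v, w] =
      stdSymplecticForm (mfderiv (𝓡 4) 𝓘(ℝ, E4) ψ x v) (mfderiv (𝓡 4) 𝓘(ℝ, E4) ψ x w)) →
    R ≤ R₂ → R₂ < R₃ →
    ContMDiffOn (𝓡 4) 𝓘(ℝ, E4) ∞ Φ₀ (K ∪ {x | ‖ψ x‖ < R₃}) →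
    Set.BijOn Φ₀ (K ∪ {x | ‖ψ x‖ < R₃}) (Metric.ball (0 : E4) R₃) →
    (∀ x ∈ K ∪ {x | ‖ψ x‖ < R₃}, Function.Bijective (mfderiv (𝓡 4) 𝓘(ℝ, E4) Φ₀ x)) →
    (∀ x ∈ K ∪ {x | ‖ψ x‖ < R₃}, ∀ v w, sf x ![v, w] =
      stdSymplecticForm (mfderiv (𝓡 4) 𝓘(ℝ, E4) Φ₀ x v) (mfderiv (𝓡 4) 𝓘(ℝ, E4) Φ₀ x w)) →
    (∀ x, x ∉ K → R₂ < ‖ψ x‖ → ‖ψ x‖ < R₃ → Φ₀ x = ψ x) →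
    ∃ Φ : M ≃ₘ⟮𝓡 4, 𝓡 4⟯ E4,
      (∀ x v w, sf x ![v, w] =
        stdSymplecticForm (mfderiv (𝓡 4) 𝓘(ℝ, E4) Φ x v) (mfderiv (𝓡 4) 𝓘(ℝ, E4) Φ x w)) ∧
      ∃ K' : Set M, IsCompact K' ∧ ∀ x, x ∉ K' → Φ x = ψ x


/-! ### Card 1, stub (S5): the pointwise TAME-SPLIT lemma on `ℝ⁴` — PROVED

If a real-linear `A` sends the `J`-complex plane spanned by `v₁, J v₁` into `ℂ × 0` (coordinates
2, 3 vanish) and the plane spanned by `v₂, J v₂` into `0 × ℂ` (coordinates 0, 1 vanish), and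
`ω₀(A vᵢ, A (J vᵢ)) > 0` for `i = 1, 2`, then `ω₀(A v, A (J v)) > 0` for every non-zero `v` in the
span of `v₁, J v₁, v₂, J v₂` (Wendl 2018, proof of Thm 6.8, p. 139: "σ₁ ⊕ σ₂ also tames J₀").
-/

/-- `ω₀` vanishes on a pair (horizontal vector, vertical vector). -/
theorem stdSymplecticForm_horiz_vert (p q : E4) (hp2 : p 2 = 0) (hp3 : p 3 = 0)
    (hq0 : q 0 = 0) (hq1 : q 1 = 0) : stdSymplecticForm p q = 0 := by
  simp [stdSymplecticForm, hp2, hp3, hq0, hq1]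

/-- `ω₀` vanishes on a pair (vertical vector, horizontal vector). -/
theorem stdSymplecticForm_vert_horiz (p q : E4) (hp0 : p 0 = 0) (hp1 : p 1 = 0)
    (hq2 : q 2 = 0) (hq3 : q 3 = 0) : stdSymplecticForm p q = 0 := by
  simp [stdSymplecticForm, hp0, hp1, hq2, hq3]

/-- `ω₀` is bilinear: additivity and homogeneity in each slot. -/
theorem stdSymplecticForm_add_left (p p' q : E4) :
    stdSymplecticForm (p + p') q = stdSymplecticForm p q + stdSymplecticForm p' q := by
  simp only [stdSymplecticForm, PiLp.add_apply]; ring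

theorem stdSymplecticForm_add_right (p q q' : E4) :
    stdSymplecticForm p (q + q') = stdSymplecticForm p q + stdSymplecticForm p q' := by
  simp only [stdSymplecticForm, PiLp.add_apply]; ring

theorem stdSymplecticForm_smul_left (c : ℝ) (p q : E4) :
    stdSymplecticForm (c • p) q = c * stdSymplecticForm p q := by
  simp only [stdSymplecticForm, PiLp.smul_apply, smul_eq_mul]; ring

theorem stdSymplecticForm_smul_right (c : ℝ) (p q : E4) :
    stdSymplecticForm p (c • q) = c * stdSymplecticForm p q := by
  simp only [stdSymplecticForm, PiLp.smul_apply, smul_eq_mul]; ring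

theorem stdSymplecticForm_neg_right (p q : E4) :
    stdSymplecticForm p (-q) = - stdSymplecticForm p q := by
  simp only [stdSymplecticForm, PiLp.neg_apply]; ring

/-- **Tame-split lemma** (pointwise, on the model `ℝ⁴`). -/
theorem tameSplit (J A : E4 →ₗ[ℝ] E4) (v₁ v₂ : E4)
    (hJ : ∀ v, J (J v) = -v)
    (h₁2 : (A v₁) 2 = 0) (h₁3 : (A v₁) 3 = 0) (h₁2' : (A (J v₁)) 2 = 0) (h₁3' : (A (J v₁)) 3 = 0)
    (h₂0 : (A v₂) 0 = 0) (h₂1 : (A v₂) 1 = 0) (h₂0' : (A (J v₂)) 0 = 0) (h₂1' : (A (J v₂)) 1 = 0)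
    (hpos₁ : 0 < stdSymplecticForm (A v₁) (A (J v₁)))
    (hpos₂ : 0 < stdSymplecticForm (A v₂) (A (J v₂)))
    (a b c d : ℝ) (hne : a ≠ 0 ∨ b ≠ 0 ∨ c ≠ 0 ∨ d ≠ 0) :
    0 < stdSymplecticForm (A (a • v₁ + b • J v₁ + c • v₂ + d • J v₂))
          (A (J (a • v₁ + b • J v₁ + c • v₂ + d • J v₂))) := by
  -- names for the four image vectors
  set x := A v₁ with hx
  set y := A (J v₁) with hy
  set x' := A v₂ with hx'
  set y' := A (J v₂) with hy'
  have hJv : J (a • v₁ + b • J v₁ + c • v₂ + d • J v₂) = a • J v₁ + b • (-v₁) + c • J v₂ + d • (-v₂) := by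
    simp only [map_add, map_smul, hJ]
  have hAv : A (a • v₁ + b • J v₁ + c • v₂ + d • J v₂) = a • x + b • y + c • x' + d • y' := by
    simp only [map_add, map_smul, hx, hy, hx', hy']
  have hAJv : A (J (a • v₁ + b • J v₁ + c • v₂ + d • J v₂)) = a • y + (-b) • x + c • y' + (-d) • x' := by
    rw [hJv]; simp only [map_add, map_smul, map_neg, hx, hy, hx', hy', smul_neg, neg_smul]
  rw [hAv, hAJv]
  -- expand by bilinearity
  have key : stdSymplecticForm (a • x + b • y + c • x' + d • y') (a • y + (-b) • x + c • y' + (-d) • x')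
      = (a ^ 2 + b ^ 2) * stdSymplecticForm x y + (c ^ 2 + d ^ 2) * stdSymplecticForm x' y' := by
    have hxx : stdSymplecticForm x x = 0 := stdSymplecticForm_self x
    have hyy : stdSymplecticForm y y = 0 := stdSymplecticForm_self y
    have hx'x' : stdSymplecticForm x' x' = 0 := stdSymplecticForm_self x'
    have hy'y' : stdSymplecticForm y' y' = 0 := stdSymplecticForm_self y'
    have hyx : stdSymplecticForm y x = - stdSymplecticForm x y := stdSymplecticForm_swap x y
    have hy'x' : stdSymplecticForm y' x' = - stdSymplecticForm x' y' := stdSymplecticForm_swap x' y'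
    -- cross terms vanish (horizontal/vertical)
    have c1 : stdSymplecticForm x y' = 0 := stdSymplecticForm_horiz_vert x y' h₁2 h₁3 h₂0' h₂1'
    have c2 : stdSymplecticForm x x' = 0 := stdSymplecticForm_horiz_vert x x' h₁2 h₁3 h₂0 h₂1
    have c3 : stdSymplecticForm y y' = 0 := stdSymplecticForm_horiz_vert y y' h₁2' h₁3' h₂0' h₂1'
    have c4 : stdSymplecticForm y x' = 0 := stdSymplecticForm_horiz_vert y x' h₁2' h₁3' h₂0 h₂1
    have c5 : stdSymplecticForm x' y = 0 := stdSymplecticForm_vert_horiz x' y h₂0 h₂1 h₁2' h₁3'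
    have c6 : stdSymplecticForm x' x = 0 := stdSymplecticForm_vert_horiz x' x h₂0 h₂1 h₁2 h₁3
    have c7 : stdSymplecticForm y' y = 0 := stdSymplecticForm_vert_horiz y' y h₂0' h₂1' h₁2' h₁3'
    have c8 : stdSymplecticForm y' x = 0 := stdSymplecticForm_vert_horiz y' x h₂0' h₂1' h₁2 h₁3
    simp only [stdSymplecticForm_add_left, stdSymplecticForm_add_right, stdSymplecticForm_smul_left,
      stdSymplecticForm_smul_right, hxx, hyy, hx'x', hy'y', hyx, hy'x', c1, c2, c3, c4, c5, c6, c7, c8]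
    ring
  rw [key]
  have hab : 0 ≤ a ^ 2 + b ^ 2 := by positivity
  have hcd : 0 ≤ c ^ 2 + d ^ 2 := by positivity
  rcases hne with h | h | h | h
  · have : 0 < a ^ 2 + b ^ 2 := by positivity
    nlinarith [mul_pos this hpos₁, mul_nonneg hcd hpos₂.le]
  · have : 0 < a ^ 2 + b ^ 2 := by positivity
    nlinarith [mul_pos this hpos₁, mul_nonneg hcd hpos₂.le]
  · have : 0 < c ^ 2 + d ^ 2 := by positivity
    nlinarith [mul_pos this hpos₂, mul_nonneg hab hpos₁.le]
  · have : 0 < c ^ 2 + d ^ 2 := by positivity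
    nlinarith [mul_pos this hpos₂, mul_nonneg hab hpos₁.le]

end Summit.SmoothPoincare4.SmoothPoincare4.Cruxes.GromovRecognitionRelEnd.SketchIdeator2

end
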